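import Mathlib

/-!
# Needle portrait: the RISE LEMMA (ROUND-37 plate t38b, typing gap G2)

The one-dimensional Jacobian step of the volume-only feeding law (F) of ROUND-37 («the feeding-time
race», seat nsreg-p2; `HOME/ns-regularity-ideate-p2/ROUND-37.md` §2 (2), §4 gap G2).  Helper material
for crux E (`EulerZoomLiouville.PowerGaugeEulerLiouville`, stmt-NavierStokesRegularity-19832); pure real
analysis, nothing Euler-specific, nothing wired into the LEAD's skeleton.

* `volume_le_lintegral_deriv_rise` — let `r : ℝ → ℝ` be differentiable with measurable derivative `r'`,
  `s₁ ≤ s₂`, and `G ⊆ [r s₁, r s₂]` measurable.  Then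
  `|G| ≤ ∫⁻_{s ∈ [s₁,s₂], r s ∈ G, r' s > 0} r' s ds`:
  every level `ϱ ∈ G` below `r s₂` is attained at its LAST PASSAGE time `σ = sup {s ≤ s₂ : r s ≤ ϱ}`, where
  `r σ = ϱ` and `r' σ ≥ 0`; the critical set `{r' = 0}` has a null image
  (`addHaar_image_le_lintegral_abs_det_fderiv` in dimension one), so only rising passages through `G` are
  charged.  (In (F): `r s = ‖Φ_s(a)‖` along a backward trajectory, `G` = the good radii in `[R, 2R]`,
  and `r' ≤ |V|` on rising passages.)
* `volume_toReal_le_integral_deriv_rise` — the Bochner form for continuous `r'`.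
-/

open MeasureTheory Set Filter Topology

set_option linter.dupNamespace false

namespace Summit.NavierStokesRegularity.NavierStokesRegularity.Theorems.PowerGaugeEulerLiouville.NeedleRise

/-- One-dimensional area formula inequality: `|r '' s| ≤ ∫⁻_s |r'|` for `r` differentiable on a measurable
`s` (no injectivity). -/
theorem volume_image_le_lintegral_abs_deriv {r r' : ℝ → ℝ} {s : Set ℝ} (hs : MeasurableSet s)
    (hr : ∀ x ∈ s, HasDerivWithinAt r (r' x) s x) :
    volume (r '' s) ≤ ∫⁻ x in s, ENNReal.ofReal |r' x| := by
  simpa only [ContinuousLinearMap.det_toSpanSingleton] using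
    addHaar_image_le_lintegral_abs_det_fderiv volume hs (fun x hx => (hr x hx).hasFDerivWithinAt)

/-- **Last passage.**  If `r` is differentiable, `s₁ ≤ s₂`, `r s₁ ≤ ϱ < r s₂`, then there is
`σ ∈ [s₁, s₂)` with `r σ = ϱ`, `0 ≤ r' σ` (and `r > ϱ` on `(σ, s₂]`). -/
theorem exists_lastPassage {r r' : ℝ → ℝ} (hr : ∀ s, HasDerivAt r (r' s) s) {s₁ s₂ ϱ : ℝ}
    (hs : s₁ ≤ s₂) (h₁ : r s₁ ≤ ϱ) (h₂ : ϱ < r s₂) :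
    ∃ σ ∈ Icc s₁ s₂, r σ = ϱ ∧ 0 ≤ r' σ := by
  have hrc : Continuous r := continuous_iff_continuousAt.2 fun s => (hr s).continuousAt
  set L : Set ℝ := Icc s₁ s₂ ∩ {s | r s ≤ ϱ} with hL
  have hLc : IsClosed L := isClosed_Icc.inter (isClosed_le hrc continuous_const)
  have hLne : L.Nonempty := ⟨s₁, ⟨le_rfl, hs⟩, h₁⟩
  have hLb : BddAbove L := ⟨s₂, fun s hs' => hs'.1.2⟩
  set σ := sSup L with hσ
  have hσL : σ ∈ L := hLc.csSup_mem hLne hLb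
  have hσ₂ : σ < s₂ := lt_of_le_of_ne hσL.1.2 fun h => by
    have := hσL.2; rw [h] at this; exact absurd h₂ (not_lt.2 this)
  -- `r > ϱ` on `(σ, s₂]`
  have habove : ∀ s, σ < s → s ≤ s₂ → ϱ < r s := by
    intro s h1 h2
    by_contra hle; push Not at hle
    have : s ∈ L := ⟨⟨hσL.1.1.trans h1.le, h2⟩, hle⟩
    exact absurd (le_csSup hLb this) (not_le.2 h1)
  -- eventually, to the right of `σ`, `ϱ < r s`
  have hev : ∀ᶠ s in 𝓝[>] σ, ϱ < r s := by
    filter_upwards [Ioo_mem_nhdsGT hσ₂] with s hs' using habove s hs'.1 hs'.2.le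
  -- continuity from the right: `ϱ ≤ r σ`, hence `r σ = ϱ`
  have hge : ϱ ≤ r σ :=
    ge_of_tendsto ((hrc.tendsto σ).mono_left nhdsWithin_le_nhds) (hev.mono fun s h => h.le)
  have heq : r σ = ϱ := le_antisymm hσL.2 hge
  refine ⟨σ, hσL.1, heq, ?_⟩
  -- derivative sign: a negative slope limit would put `r < ϱ` just to the right of `σ`
  by_contra hneg; push Not at hneg
  have hsl : Tendsto (slope r σ) (𝓝[>] σ) (𝓝 (r' σ)) :=
    (hasDerivAt_iff_tendsto_slope.1 (hr σ)).mono_left (nhdsWithin_mono _ fun s hs' => ne_of_gt hs')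
  have hev2 : ∀ᶠ s in 𝓝[>] σ, slope r σ s < 0 := (tendsto_order.1 hsl).2 0 hneg
  obtain ⟨s, hs1, hs2, hs3⟩ := (hev.and (hev2.and self_mem_nhdsWithin)).exists
  rw [slope_def_field, heq] at hs2
  have : 0 < (r s - ϱ) / (s - σ) := div_pos (sub_pos.2 hs1) (sub_pos.2 hs3)
  linarith

/-- **Rise lemma (ROUND-37 gap G2).**  Let `r : ℝ → ℝ` be differentiable everywhere with measurable
derivative `r'`, `s₁ ≤ s₂`, and let `G ⊆ [r s₁, r s₂]` be measurable.  Then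
`|G| ≤ ∫⁻_{E₊} r'`, where `E₊ = {s ∈ [s₁, s₂] : r s ∈ G, 0 < r' s}` is the set of RISING passages through `G`. -/
theorem volume_le_lintegral_deriv_rise {r r' : ℝ → ℝ} (hr : ∀ s, HasDerivAt r (r' s) s)
    (hr'm : Measurable r') {s₁ s₂ : ℝ} (hs : s₁ ≤ s₂) {G : Set ℝ} (hG : MeasurableSet G)
    (hGsub : G ⊆ Icc (r s₁) (r s₂)) :
    volume G ≤ ∫⁻ s in Icc s₁ s₂ ∩ r ⁻¹' G ∩ {s | 0 < r' s}, ENNReal.ofReal (r' s) := by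
  have hrc : Continuous r := continuous_iff_continuousAt.2 fun s => (hr s).continuousAt
  set Ep : Set ℝ := Icc s₁ s₂ ∩ r ⁻¹' G ∩ {s | 0 < r' s} with hEp
  set Ez : Set ℝ := Icc s₁ s₂ ∩ {s | r' s = 0} with hEz
  have hEpm : MeasurableSet Ep :=
    (measurableSet_Icc.inter (hG.preimage hrc.measurable)).inter (measurableSet_lt measurable_const hr'm)
  have hEzm : MeasurableSet Ez :=
    measurableSet_Icc.inter (measurableSet_eq_fun hr'm measurable_const)
  -- (A) covering: `G ⊆ r '' Ep ∪ r '' Ez ∪ {r s₂}`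
  have hcover : G ⊆ r '' Ep ∪ r '' Ez ∪ {r s₂} := by
    intro ϱ hϱ
    rcases eq_or_lt_of_le (hGsub hϱ).2 with h | h
    · exact Or.inr (mem_singleton_iff.2 h)
    obtain ⟨σ, hσI, hσr, hσ'⟩ := exists_lastPassage hr hs (hGsub hϱ).1 h
    rcases hσ'.eq_or_lt with h0 | hpos
    · exact Or.inl (Or.inr ⟨σ, ⟨hσI, h0.symm⟩, hσr⟩)
    · refine Or.inl (Or.inl ⟨σ, ⟨⟨hσI, ?_⟩, hpos⟩, hσr⟩)
      show r σ ∈ G; rw [hσr]; exact hϱ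
  -- (B) the critical set has a null image
  have hcrit : volume (r '' Ez) = 0 := by
    refine le_antisymm ?_ bot_le
    calc volume (r '' Ez) ≤ ∫⁻ s in Ez, ENNReal.ofReal |r' s| :=
          volume_image_le_lintegral_abs_deriv hEzm fun s _ => (hr s).hasDerivWithinAt
      _ = ∫⁻ s in Ez, 0 := setLIntegral_congr_fun hEzm fun s hs' => by
          have : r' s = 0 := hs'.2
          simp [this]
      _ = 0 := lintegral_zero
  -- (C) the rising set is charged by `r'`
  have hrise : volume (r '' Ep) ≤ ∫⁻ s in Ep, ENNReal.ofReal (r' s) := by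
    calc volume (r '' Ep) ≤ ∫⁻ s in Ep, ENNReal.ofReal |r' s| :=
          volume_image_le_lintegral_abs_deriv hEpm fun s _ => (hr s).hasDerivWithinAt
      _ = ∫⁻ s in Ep, ENNReal.ofReal (r' s) := setLIntegral_congr_fun hEpm fun s hs' => by
          rw [abs_of_pos (show 0 < r' s from hs'.2)]
  calc volume G ≤ volume (r '' Ep ∪ r '' Ez ∪ {r s₂}) := measure_mono hcover
    _ ≤ volume (r '' Ep ∪ r '' Ez) + volume ({r s₂} : Set ℝ) := measure_union_le _ _
    _ ≤ volume (r '' Ep) + volume (r '' Ez) + volume ({r s₂} : Set ℝ) :=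
        by gcongr; exact measure_union_le _ _
    _ = volume (r '' Ep) := by rw [hcrit, Real.volume_singleton, add_zero, add_zero]
    _ ≤ ∫⁻ s in Ep, ENNReal.ofReal (r' s) := hrise

/-- **Rise lemma, Bochner form.**  With `r'` continuous the bound reads
`|G| ≤ ∫_{Ep} r'` as real numbers (`E₊` as in `volume_le_lintegral_deriv_rise`). -/
theorem volume_toReal_le_integral_deriv_rise {r r' : ℝ → ℝ} (hr : ∀ s, HasDerivAt r (r' s) s)
    (hr'c : Continuous r') {s₁ s₂ : ℝ} (hs : s₁ ≤ s₂) {G : Set ℝ} (hG : MeasurableSet G)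
    (hGsub : G ⊆ Icc (r s₁) (r s₂)) :
    (volume G).toReal ≤ ∫ s in Icc s₁ s₂ ∩ r ⁻¹' G ∩ {s | 0 < r' s}, r' s := by
  have hrc : Continuous r := continuous_iff_continuousAt.2 fun s => (hr s).continuousAt
  set Ep : Set ℝ := Icc s₁ s₂ ∩ r ⁻¹' G ∩ {s | 0 < r' s} with hEp
  have hEpm : MeasurableSet Ep :=
    (measurableSet_Icc.inter (hG.preimage hrc.measurable)).inter
      (measurableSet_lt measurable_const hr'c.measurable)
  have hint : IntegrableOn r' Ep volume :=
    (hr'c.continuousOn.integrableOn_compact isCompact_Icc).mono_set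
      (inter_subset_left.trans inter_subset_left)
  have hnn : 0 ≤ᵐ[volume.restrict Ep] r' :=
    (ae_restrict_mem hEpm).mono fun s hs' => (show 0 < r' s from hs'.2).le
  have h := volume_le_lintegral_deriv_rise hr hr'c.measurable hs hG hGsub
  rw [← ofReal_integral_eq_lintegral_ofReal hint hnn] at h
  exact ENNReal.toReal_le_of_le_ofReal (integral_nonneg_of_ae hnn) h

end Summit.NavierStokesRegularity.NavierStokesRegularity.Theorems.PowerGaugeEulerLiouville.NeedleRise
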